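import Summits.BirchSwinnertonDyer.BirchSwinnertonDyer.Theorems.BiquadraticEisensteinDescentEisensteinHeartFlatCMInertBadKPrimeKatzHsiehRigidity
import Literature.NumberTheory.EllipticCurves.KatzPAdicLFunctionCMFieldBaseChangeLineProofs
import HarnessLib

set_option linter.dupNamespace false -- `Summit.BirchSwinnertonDyer.BirchSwinnertonDyer.Theorems.…` (summit = sub)
set_option autoImplicit false

/-!
# Crux `EisensteinHeartFlatCMInertBadKPrime` (stmt-BirchSwinnertonDyer-21341), line `hsieh-lambda`, layer 2 (V2):
# the POINTWISE DISPLAY RELATION between a Katz base-change-line frame and a Hsieh witness, discharged down to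
# print-shaped hypotheses (two complex places, Katz type `k = 1`, `κ = (n, n−1)`; `a_p(f) = 0`, `p ∣ N`; the branch
# character ramified on `S ∪ {w ∣ p} ∪ Σ_p ∪ T`; ONE `L`-value identity)

Route `BiquadraticEisensteinDescent` (cell `pub/bsd-wall`, width seat `bsd-wall-cm-bed-w3`; lead `bsd-wall-cm-bed-p1`,
`LAYER2-VOCAB-BRIEF.md` V2). Sequel of `…KatzHsiehRigidity.lean` (the V2 socket
`exists_span_C_mul_eq_of_isBaseChangeLine`, whose one remaining hypothesis `hdisp` is produced here). THEOREMS ONLY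
(no definition, no named fact, no `sorry`); supports stmt-BirchSwinnertonDyer-21341 as a helper; nothing about the
crux's input or any case of BSD is asserted.

## What is proved

For a subfield `K ⊂ L` (`L/K` Galois) with EXACTLY TWO infinite places `w₁ ≠ w₂` of `L` (the biquadratic CM field
`L = K_CM·K′` over the Heegner field `K = K′`), a Katz base-change-line datum `(ι, Σ_p, S, T, λ, ϑ, C_K, Ω, Ω_p′)`
(`KatzCM.IsBaseChangeLine`, Hsieh Crelle 688 Prop. 4.9 read downstairs) and a Hsieh datum `(𝔭, f, A, Ω_K, C_H, Ω_p)`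
(`IsHsiehLFunction`, Hsieh Doc. Math. 19 Thm. A), the two displays at a character `χ` of Hsieh's range (unramified,
type `(n, −n)`, `n ≥ 1`) satisfy

  `ι⁻¹(KatzCM.interpolationValue ι Σ_p S T λ (χ∘N) 1 κ_n ϑ C_K Ω (L(λ·χ∘N, 0))) · ∏_w Ω_{p,w}′^{1+2κ_n(w)}
     = c₀ · c₁ⁿ · δ(χ) · ι⁻¹(hsiehInterpolationValue p f 𝔭 χ n A Ω_K C_H) · Ω_p^{4n}`             (`display_relation`)

with `κ_n = (n at w₁, n − 1 at w₂)`, EXPLICIT non-zero constants `c₀ = ι⁻¹(C_K c_L Im σ₂(ϑ) Ω₂/(C_H Ω₁))·Ω′_{p,1}/Ω′_{p,2}`,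
`c₁ = ι⁻¹(c_L′ π⁴ A² 16 Ω_K⁴/(p · Im σ₁(ϑ) Im σ₂(ϑ) Ω₁² Ω₂²))·(Ω′_{p,1}Ω′_{p,2})²/Ω_p⁴` and the power-multiplicative
defect `δ(χ) = ι⁻¹ ∏_{w ∈ Σ_p ∪ T} (χ∘N)(ϖ_w)^{−a(λ_w)}` (the `ρ`-dependent part of `KatzCM.eulerFactor`), GRANTED:
(T) the Katz type of `λ · χ∘N_{L/K}` on the range is `k = 1`, `κ_n` (`HasKatzType`; for `λ = ψ_W∘N_{L/K_CM}·N_L⁻¹` and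
`Σ = {σ̄₁, σ̄₂}` this is the computation `nσ₁ − (n+1)σ̄₁ + (n−1)σ₂ − nσ̄₂ = −(1+κ)Σ̄… `, left to the instantiation);
(C) an entire continuation of `L(λ·χ∘N, s)` exists on the range; (L) THE `L`-VALUE IDENTITY
`L(λ·χ∘N_{L/K}, 0) = c_L · c_L′ⁿ · L(f/K, χ, 1)` with `c_L, c_L′ ≠ 0` (`rankinSelbergValueHecke f χ 1`; for the CM
form `f = θ_{ψ_W}` and `K_CM ≠ K′` this is automorphic induction / Artin formalism
`L(s, π_{f,K′} ⊗ χ) = L(s, ψ_L · χ_L)` Euler factor by Euler factor, `c_L = c_L′ = 1` — NOT asserted here);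
(P) `p ∣ N` and `a_p(f) = 0` (`cuspCoeff f p = 0`; CM and additive at `p`), so Hsieh's Euler polynomial is `1` and the
Steinberg power `pⁿ` is present (`hsiehInterpolationValue_of_dvd`); (R) `λ` is RAMIFIED at every place of
`S ∪ {w ∣ p}` (so every removed Euler factor `1 − \widetilde{λχ∘N}(w)` is `1`) and of `Σ_p ∪ T` (so the `L`-ratio
in `eulerFactor` is `1`); (N) non-vanishing of `C_K, Ω_w, Im σ_w(ϑ), Ω′_{p,w}, A, Ω_K, C_H, Ω_p`.
Then **`exists_span_C_mul_eq`**: with a Katz series `G` and a Hsieh witness `Q_H` on these data (odd `p`, `K`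
imaginary quadratic, `κ` anticyclotomic, `γ` a topological generator), `(C(c)·G) = (C(c′)·Q_H)` for some
`c, c′ ∈ 𝒪_{ℂ_p} ∖ 0` — the `hspan` of `…ConstantScaling.heartShape_of_sockets`. So of layer 2's (E1a) what remains
OPEN after this file is exactly (T)+(L) at the route's `λ` (print-shaped), and the existence of the Katz series
(`KatzCM.exists_isBaseChangeLine'`, granted `hsieh2014mu_prop49_exists_isMeasure`).

References: [Hsieh2014mu] Prop. 4.9 (§4.8), §4.7 (`Eul`); [Hsieh2014] Thm. A (Doc. Math. 19 p. 712);
[Katz1978] (5.3.0); [Castella2018] Thm. 3.1.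
-/

noncomputable section

open scoped Classical Topology NumberField
open Filter NumberField IsDedekindDomain Field PowerSeries Finset
open Literature.NumberTheory.EllipticCurves Literature.NumberTheory.GaloisRepresentations
open Literature.NumberTheory.EllipticCurves.ModularForms

namespace Summit.BirchSwinnertonDyer.BirchSwinnertonDyer.Theorems.BiquadraticEisensteinDescentEisensteinHeartFlatCMInertBadKPrimeKatzHsiehDisplay

open Summit.BirchSwinnertonDyer.BirchSwinnertonDyer.Theorems.BiquadraticEisensteinDescentEisensteinHeartFlatCMInertBadKPrimeKatzHsiehRigidity

variable {p : ℕ} [Fact p.Prime] {K L : Type} [Field K] [NumberField K] [Field L] [NumberField L]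
  [Algebra K L] [IsGalois K L]

/-! ### §1 Local factors of the Katz display on a branch ramified at the bookkept places -/

/-- **All removed Euler factors are `1` on a ramified set**: if `ε` is ramified at every `w ∈ X` then
`∏_{w ∈ X} (1 − ε̃(w)) = 1` (`ε̃(w) = 0` at a ramified place, `heckeValueExtZero`). [cite: Hsieh2014mu, Prop. 4.9 (§4.8)] -/
theorem removedEulerFactorsAtZero_eq_one {ε : HeckeCharacter L} {X : Finset (HeightOneSpectrum (𝓞 L))}
    (h : ∀ w ∈ X, ¬ ε.IsUnramifiedAt w) : DeShalit1987.removedEulerFactorsAtZero ε X = 1 := by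
  unfold DeShalit1987.removedEulerFactorsAtZero
  refine Finset.prod_eq_one fun w hw ↦ ?_
  rw [heckeValueExtZero_of_not_isUnramifiedAt (h w hw), sub_zero]

/-- `λρ` is ramified where `λ` is, for `ρ` unramified there. [cite: TateThesis1967, §2.3] -/
theorem not_isUnramifiedAt_mul {lam ρ : HeckeCharacter L} {w : HeightOneSpectrum (𝓞 L)}
    (hρ : ρ.IsUnramifiedAt w) (hlam : ¬ lam.IsUnramifiedAt w) : ¬ (lam * ρ).IsUnramifiedAt w :=
  fun h ↦ hlam ((KatzCM.isUnramifiedAt_mul_iff_of_range hρ).mp h)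

/-- **The Katz Euler factor at a place where `λρ` is ramified is `ρ(ϖ_w)^{−a(λ_w)}`**: the `L`-ratio
`L(0, χ_w)/L(1, χ_w⁻¹)` is `1` (`χ̃_w = 0 = χ̃_w⁻¹` there). [cite: Hsieh2014mu, §4.7 (`Eul(χ_w)`)] -/
theorem eulerFactor_eq_of_not_isUnramifiedAt {lam ρ : HeckeCharacter L} {w : HeightOneSpectrum (𝓞 L)}
    (h : ¬ (lam * ρ).IsUnramifiedAt w) :
    KatzCM.eulerFactor lam ρ w = ρ.valueAtUniformizer w ^ (-(lam.conductorExponentAt w : ℤ)) := by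
  have h' : ¬ (lam * ρ)⁻¹.IsUnramifiedAt w := fun h'' ↦ h (by simpa using h''.inv')
  unfold KatzCM.eulerFactor
  rw [heckeValueExtZero_of_not_isUnramifiedAt h, heckeValueExtZero_of_not_isUnramifiedAt h', zero_mul,
    sub_zero, div_one, mul_one]

/-- Values at uniformisers of natural powers. [cite: TateThesis1967, §2.5] -/
theorem valueAtUniformizer_pow (η : HeckeCharacter L) (k : ℕ) (w : HeightOneSpectrum (𝓞 L)) :
    (η ^ k).valueAtUniformizer w = η.valueAtUniformizer w ^ k := by
  simp only [HeckeCharacter.valueAtUniformizer, HeckeCharacter.localComponent_apply, HeckeCharacter.pow_apply,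
    Units.val_pow_eq_pow_val]

/-- `(χ^k) ∘ N = (χ ∘ N)^k`. [cite: CasselsFrohlichANT1967, Ch. VII Prop. 4.3] -/
theorem compRelNorm_pow' (χ : HeckeCharacter K) (k : ℕ) : (χ ^ k).compRelNorm L = (χ.compRelNorm L) ^ k := by
  refine HeckeCharacter.ext fun y => ?_
  rw [HeckeCharacter.compRelNorm_apply, HeckeCharacter.pow_apply, HeckeCharacter.pow_apply,
    HeckeCharacter.compRelNorm_apply]

/-- **The product of the Katz Euler factors over `Σ_p ∪ T` on the range is the multiplicative defect**
`∏_{w ∈ Σ_p ∪ T} (χ∘N)(ϖ_w)^{−a(λ_w)}` when `λ` is ramified on `Σ_p ∪ T` and `χ` is unramified everywhere.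
[cite: Hsieh2014mu, §4.7 (`Eul_p`, `Eul_{𝔠⁺}`)] -/
theorem prod_eulerFactor_eq {Sp T : Finset (HeightOneSpectrum (𝓞 L))} {lam : HeckeCharacter L}
    (hram : ∀ w ∈ Sp ∪ T, ¬ lam.IsUnramifiedAt w) {χ : HeckeCharacter K}
    (hu : ∀ v : HeightOneSpectrum (𝓞 K), χ.IsUnramifiedAt v) :
    ∏ w ∈ Sp ∪ T, KatzCM.eulerFactor lam (χ.compRelNorm L) w =
      ∏ w ∈ Sp ∪ T, (χ.compRelNorm L).valueAtUniformizer w ^ (-(lam.conductorExponentAt w : ℤ)) := by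
  refine Finset.prod_congr rfl fun w hw ↦ ?_
  exact eulerFactor_eq_of_not_isUnramifiedAt
    (not_isUnramifiedAt_mul (compRelNorm_isUnramifiedAt_of_forall hu w) (hram w hw))

/-- The defect is power-multiplicative in `χ`. [cite: TateThesis1967, §2.5] -/
theorem defect_pow {Sp T : Finset (HeightOneSpectrum (𝓞 L))} {lam : HeckeCharacter L} (χ : HeckeCharacter K)
    (k : ℕ) :
    ∏ w ∈ Sp ∪ T, ((χ ^ k).compRelNorm L).valueAtUniformizer w ^ (-(lam.conductorExponentAt w : ℤ)) =
      (∏ w ∈ Sp ∪ T, (χ.compRelNorm L).valueAtUniformizer w ^ (-(lam.conductorExponentAt w : ℤ))) ^ k := by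
  rw [← Finset.prod_pow]
  refine Finset.prod_congr rfl fun w _ ↦ ?_
  rw [compRelNorm_pow', valueAtUniformizer_pow, ← zpow_natCast, ← zpow_natCast, ← zpow_mul, ← zpow_mul,
    mul_comm]

/-- The defect is non-zero (values of Hecke characters are units). [cite: TateThesis1967, §2.5] -/
theorem defect_ne_zero {Sp T : Finset (HeightOneSpectrum (𝓞 L))} {lam : HeckeCharacter L} (χ : HeckeCharacter K) :
    ∏ w ∈ Sp ∪ T, (χ.compRelNorm L).valueAtUniformizer w ^ (-(lam.conductorExponentAt w : ℤ)) ≠ 0 := by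
  refine Finset.prod_ne_zero_iff.mpr fun w _ ↦ zpow_ne_zero _ ?_
  exact Units.ne_zero _

/-! ### §2 Two infinite places: sums and products over `InfinitePlace L` -/

/-- `univ = {w₁, w₂}` for a field with exactly the two infinite places `w₁ ≠ w₂`. [folklore] -/
theorem univ_eq_pair {w₁ w₂ : InfinitePlace L} (huniv : ∀ w : InfinitePlace L, w = w₁ ∨ w = w₂) :
    (Finset.univ : Finset (InfinitePlace L)) = {w₁, w₂} := by
  ext w
  simp only [Finset.mem_univ, Finset.mem_insert, Finset.mem_singleton, true_iff]
  exact huniv w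

/-- `∏_w g(w) = g(w₁) g(w₂)` over the two infinite places. [folklore] -/
theorem prod_univ_two {M : Type*} [CommMonoid M] {w₁ w₂ : InfinitePlace L} (hw : w₁ ≠ w₂)
    (huniv : ∀ w : InfinitePlace L, w = w₁ ∨ w = w₂) (g : InfinitePlace L → M) :
    ∏ w, g w = g w₁ * g w₂ := by
  rw [univ_eq_pair huniv, Finset.prod_pair hw]

/-- `∑_w g(w) = g(w₁) + g(w₂)` over the two infinite places. [folklore] -/
theorem sum_univ_two {M : Type*} [AddCommMonoid M] {w₁ w₂ : InfinitePlace L} (hw : w₁ ≠ w₂)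
    (huniv : ∀ w : InfinitePlace L, w = w₁ ∨ w = w₂) (g : InfinitePlace L → M) :
    ∑ w, g w = g w₁ + g w₂ := by
  rw [univ_eq_pair huniv, Finset.sum_pair hw]

/-- **The archimedean factor of Hsieh's Prop. 4.9 at two places**, type `kΣ + κ(1 − c)` with `κ = (κ₁, κ₂)`:
`π^{κ₁+κ₂} Γ(k+κ₁)Γ(k+κ₂) / (Im σ₁(ϑ)^{κ₁} Im σ₂(ϑ)^{κ₂} Ω₁^{k+2κ₁} Ω₂^{k+2κ₂})`. [cite: Hsieh2014mu, Prop. 4.9 (§4.8)] -/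
theorem archFactor_two {ι : PadicAlgCl p ≃+* ℂ} {Sp : Finset (HeightOneSpectrum (𝓞 L))} {w₁ w₂ : InfinitePlace L}
    (hw : w₁ ≠ w₂) (huniv : ∀ w : InfinitePlace L, w = w₁ ∨ w = w₂) (k : ℕ) (κ_ : InfinitePlace L → ℕ) (ϑ : L)
    (Ω : InfinitePlace L → ℂ) :
    KatzCM.archFactor ι Sp k κ_ ϑ Ω =
      (Real.pi : ℂ) ^ (κ_ w₁ + κ_ w₂) *
        (DeShalit1987.gammaFactorAtZero (k + κ_ w₁) * DeShalit1987.gammaFactorAtZero (k + κ_ w₂)) *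
        ((((KatzCM.embeddingAt ι Sp w₁ ϑ).im : ℝ) : ℂ) ^ κ_ w₁ *
            (((KatzCM.embeddingAt ι Sp w₂ ϑ).im : ℝ) : ℂ) ^ κ_ w₂)⁻¹ *
        (Ω w₁ ^ (k + 2 * κ_ w₁) * Ω w₂ ^ (k + 2 * κ_ w₂))⁻¹ := by
  unfold KatzCM.archFactor
  rw [sum_univ_two hw huniv, prod_univ_two hw huniv, prod_univ_two hw huniv, prod_univ_two hw huniv]

/-! ### §3 The complex identity behind the display relation (pure field algebra) -/

/-- The ratio of the two complex displays at `n = m + 1`, `k = 1`, `κ = (m+1, m)`, with the `L`-values related by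
`L_Katz = c_L c_L′^{m+1} L_Hsieh`: `Katz = c₀ · c₁^{m+1} · E · Hsieh` for the explicit `c₀, c₁` of the module
docstring. [cite: Hsieh2014mu, Prop. 4.9 (§4.8)] [cite: Hsieh2014, Thm. A p. 712 (Doc. Math. 19)] -/
theorem complex_display_identity (m : ℕ) {CK cL cL' CH P A ΩK I₁ I₂ Ω₁ Ω₂ q E RS G₁ G₂ : ℂ} (hCH : CH ≠ 0)
    (hP : P ≠ 0) (hA : A ≠ 0) (hΩK : ΩK ≠ 0) (hI₁ : I₁ ≠ 0) (hI₂ : I₂ ≠ 0) (hΩ₁ : Ω₁ ≠ 0) (hΩ₂ : Ω₂ ≠ 0)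
    (hq : q ≠ 0) :
    CK * (P ^ (m + 1 + m) * (G₁ * G₂) * (I₁ ^ (m + 1) * I₂ ^ m)⁻¹ *
        (Ω₁ ^ (1 + 2 * (m + 1)) * Ω₂ ^ (1 + 2 * m))⁻¹) * 1 * E * (cL * cL' ^ (m + 1) * RS) =
      (CK * cL * I₂ * Ω₂ / (CH * Ω₁)) *
        (cL' * P ^ 4 * A ^ 2 * 16 * ΩK ^ 4 / (I₁ * I₂ * Ω₁ ^ 2 * Ω₂ ^ 2 * q)) ^ (m + 1) * E *
        (G₂ * G₁ * q ^ (m + 1) * 1 * RS * CH /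
          (A ^ (2 * (m + 1)) * (4 : ℂ) ^ (2 * (m + 1)) * P ^ (2 * (m + 1) + 1) * ΩK ^ (4 * (m + 1)))) := by
  have h4 : (4 : ℂ) ^ (2 * (m + 1)) = 16 ^ (m + 1) := by
    rw [pow_mul]; norm_num
  rw [h4, div_pow]
  simp only [mul_pow, ← pow_mul]
  field_simp
  ring

/-- The `p`-adic period bookkeeping behind the display relation (pure field algebra): with `n = m + 1`,
`Ω′_{p,1}^{2n+1} Ω′_{p,2}^{2n−1} = (Ω′_{p,1}/Ω′_{p,2}) · ((Ω′_{p,1}Ω′_{p,2})²/Ω_p⁴)ⁿ · Ω_p^{4n}`. [cite: Hsieh2014mu, Prop. 4.9 (§4.8)] -/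
theorem padic_display_identity {F : Type*} [Field F] (m : ℕ) {a b e h O₁ O₂ Op : F} (hO₂ : O₂ ≠ 0)
    (hOp : Op ≠ 0) :
    a * b ^ (m + 1) * e * h * (O₁ ^ (1 + 2 * (m + 1)) * O₂ ^ (1 + 2 * m)) =
      a * (O₁ * O₂⁻¹) * (b * ((O₁ * O₂) ^ 2 * (Op ^ 4)⁻¹)) ^ (m + 1) * e * (h * Op ^ (4 * (m + 1))) := by
  simp only [mul_pow, inv_pow, ← pow_mul]
  field_simp
  ring

/-! ### §4 The display relation -/

/-- **THE POINTWISE DISPLAY RELATION (V2, layer 2 of line `hsieh-lambda`).** See the module docstring: for `L ⊃ K`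
with exactly two infinite places `w₁ ≠ w₂`, a Katz base-change-line datum and a Hsieh datum, granted (T) the Katz type
`k = 1`, `κ_n = (n, n−1)` on the range, (C) entire continuation, (L) `L(λ·χ∘N, 0) = c_L c_L′ⁿ L(f/K, χ, 1)`,
(P) `p ∣ N`, `a_p(f) = 0`, (R) `λ` ramified on `S ∪ {w ∣ p}` and on `Σ_p ∪ T`, (N) non-vanishing — there are
`c₀, c₁ ∈ ℂ_p^×` and a power-multiplicative non-vanishing `δ` (all explicit in the proof) with, at every `χ` of
Hsieh's range, `ι⁻¹(Katz display at χ∘N with (1, κ_n, hL))·∏_w Ω′_{p,w}^{1+2κ_n(w)} = c₀ c₁ⁿ δ(χ) ι⁻¹(Hsieh display at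
χ) Ω_p^{4n}` — the hypothesis `hdisp` of `…KatzHsiehRigidity.exists_span_C_mul_eq_of_isBaseChangeLine`, in its
literal shape. [cite: Hsieh2014mu, Prop. 4.9 (§4.8), §4.7] [cite: Hsieh2014, Thm. A p. 712 (Doc. Math. 19)] -/
theorem display_relation {ι : PadicAlgCl p ≃+* ℂ} {Sp S T : Finset (HeightOneSpectrum (𝓞 L))}
    {lam : HeckeCharacter L} {ϑ : L} {CK : ℂ} {Ω : InfinitePlace L → ℂ} {ΩpK : InfinitePlace L → ℂ_[p]}
    {N : ℕ} {f : CuspForm (CongruenceSubgroup.Gamma0 N) 2} {𝔭 : HeightOneSpectrum (𝓞 K)} {A : ℝ} {ΩK CH : ℂ}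
    {Ωp : ℂ_[p]} {w₁ w₂ : InfinitePlace L} (hw : w₁ ≠ w₂) (huniv : ∀ w : InfinitePlace L, w = w₁ ∨ w = w₂)
    (hT : ∀ (χ : HeckeCharacter K) (n : ℕ), 0 < n → (∀ v : HeightOneSpectrum (𝓞 K), χ.IsUnramifiedAt v) →
      χ.HasInfinityType (fun _ ↦ (n : ℤ)) (fun _ ↦ -(n : ℤ)) →
      KatzCM.HasKatzType ι Sp (lam * χ.compRelNorm L) 1 (fun w ↦ if w = w₁ then n else n - 1))
    (hcont : ∀ (χ : HeckeCharacter K) (n : ℕ), 0 < n → (∀ v : HeightOneSpectrum (𝓞 K), χ.IsUnramifiedAt v) →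
      χ.HasInfinityType (fun _ ↦ (n : ℤ)) (fun _ ↦ -(n : ℤ)) →
      LFunction.HasEntireContinuation (heckeLFunction (lam * χ.compRelNorm L)))
    {cL cL' : ℂ} (hcL : cL ≠ 0) (hcL' : cL' ≠ 0)
    (hLval : ∀ (χ : HeckeCharacter K) (n : ℕ), 0 < n → (∀ v : HeightOneSpectrum (𝓞 K), χ.IsUnramifiedAt v) →
      χ.HasInfinityType (fun _ ↦ (n : ℤ)) (fun _ ↦ -(n : ℤ)) →
      ∀ hL : LFunction.HasEntireContinuation (heckeLFunction (lam * χ.compRelNorm L)),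
        hL.continuation 0 = cL * cL' ^ n * rankinSelbergValueHecke f χ 1)
    (hpN : p ∣ N) (hap : cuspCoeff f p = 0)
    (hramS : ∀ w ∈ S ∪ KatzCM.primesOver L p, ¬ lam.IsUnramifiedAt w)
    (hramT : ∀ w ∈ Sp ∪ T, ¬ lam.IsUnramifiedAt w)
    (hCK : CK ≠ 0) (hΩ : ∀ w, Ω w ≠ 0) (hIm : ∀ w, (KatzCM.embeddingAt ι Sp w ϑ).im ≠ 0)
    (hΩpK : ∀ w, ΩpK w ≠ 0) (hA : A ≠ 0) (hΩK : ΩK ≠ 0) (hCH : CH ≠ 0) (hΩp : Ωp ≠ 0) :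
    ∃ (c₀ c₁ : ℂ_[p]) (δ : HeckeCharacter K → ℂ_[p]), c₀ ≠ 0 ∧ c₁ ≠ 0 ∧ (∀ χ, δ χ ≠ 0) ∧
      (∀ (χ : HeckeCharacter K) (k : ℕ), δ (χ ^ k) = δ χ ^ k) ∧
      ∀ (χ : HeckeCharacter K) (n : ℕ), 0 < n → (∀ v : HeightOneSpectrum (𝓞 K), χ.IsUnramifiedAt v) →
        χ.HasInfinityType (fun _ ↦ (n : ℤ)) (fun _ ↦ -(n : ℤ)) →
        ∃ (k : ℕ) (κ_ : InfinitePlace L → ℕ)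
          (hL : LFunction.HasEntireContinuation (heckeLFunction (lam * χ.compRelNorm L))),
          1 ≤ k ∧ KatzCM.HasKatzType ι Sp (lam * χ.compRelNorm L) k κ_ ∧
          ((ι.symm (KatzCM.interpolationValue ι Sp S T lam (χ.compRelNorm L) k κ_ ϑ CK Ω
              (hL.continuation 0)) : PadicAlgCl p) : ℂ_[p]) * (∏ w, ΩpK w ^ (k + 2 * κ_ w)) =
            c₀ * c₁ ^ n * δ χ *
              ((((ι.symm (hsiehInterpolationValue p f 𝔭 χ n A ΩK CH)) : PadicAlgCl p) : ℂ_[p]) *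
                Ωp ^ (4 * n)) := by
  -- the transport `ℂ → ℚ̄_p → ℂ_p`
  set Φ : ℂ →+* ℂ_[p] := (algebraMap (PadicAlgCl p) ℂ_[p]).comp ι.symm.toRingHom with hΦdef
  have hΦ : ∀ z : ℂ, ((ι.symm z : PadicAlgCl p) : ℂ_[p]) = Φ z := fun z ↦ by
    rw [PadicComplex.coe_eq]; rfl
  have hΦ0 : ∀ {z : ℂ}, z ≠ 0 → Φ z ≠ 0 := fun hz ↦ (map_ne_zero Φ).mpr hz
  -- the non-vanishing constants
  have hI₁0 : (((KatzCM.embeddingAt ι Sp w₁ ϑ).im : ℝ) : ℂ) ≠ 0 := Complex.ofReal_ne_zero.mpr (hIm w₁)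
  have hI₂0 : (((KatzCM.embeddingAt ι Sp w₂ ϑ).im : ℝ) : ℂ) ≠ 0 := Complex.ofReal_ne_zero.mpr (hIm w₂)
  have hπ : (Real.pi : ℂ) ≠ 0 := Complex.ofReal_ne_zero.mpr Real.pi_ne_zero
  have hA' : (A : ℂ) ≠ 0 := Complex.ofReal_ne_zero.mpr hA
  have hp0 : (p : ℂ) ≠ 0 := Nat.cast_ne_zero.mpr (Fact.out : p.Prime).ne_zero
  have h16 : (16 : ℂ) ≠ 0 := by norm_num
  have hc₀ℂ : CK * cL * (((KatzCM.embeddingAt ι Sp w₂ ϑ).im : ℝ) : ℂ) * Ω w₂ / (CH * Ω w₁) ≠ 0 :=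
    div_ne_zero (mul_ne_zero (mul_ne_zero (mul_ne_zero hCK hcL) hI₂0) (hΩ w₂)) (mul_ne_zero hCH (hΩ w₁))
  have hc₁ℂ : cL' * (Real.pi : ℂ) ^ 4 * (A : ℂ) ^ 2 * 16 * ΩK ^ 4 /
      ((((KatzCM.embeddingAt ι Sp w₁ ϑ).im : ℝ) : ℂ) * (((KatzCM.embeddingAt ι Sp w₂ ϑ).im : ℝ) : ℂ) *
        Ω w₁ ^ 2 * Ω w₂ ^ 2 * (p : ℂ)) ≠ 0 :=
    div_ne_zero
      (mul_ne_zero (mul_ne_zero (mul_ne_zero (mul_ne_zero hcL' (pow_ne_zero _ hπ)) (pow_ne_zero _ hA')) h16)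
        (pow_ne_zero _ hΩK))
      (mul_ne_zero (mul_ne_zero (mul_ne_zero (mul_ne_zero hI₁0 hI₂0) (pow_ne_zero _ (hΩ w₁)))
        (pow_ne_zero _ (hΩ w₂))) hp0)
  refine ⟨Φ (CK * cL * (((KatzCM.embeddingAt ι Sp w₂ ϑ).im : ℝ) : ℂ) * Ω w₂ / (CH * Ω w₁)) *
      (ΩpK w₁ * (ΩpK w₂)⁻¹),
    Φ (cL' * (Real.pi : ℂ) ^ 4 * (A : ℂ) ^ 2 * 16 * ΩK ^ 4 /
      ((((KatzCM.embeddingAt ι Sp w₁ ϑ).im : ℝ) : ℂ) * (((KatzCM.embeddingAt ι Sp w₂ ϑ).im : ℝ) : ℂ) *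
        Ω w₁ ^ 2 * Ω w₂ ^ 2 * (p : ℂ))) * ((ΩpK w₁ * ΩpK w₂) ^ 2 * (Ωp ^ 4)⁻¹),
    fun χ ↦ Φ (∏ w ∈ Sp ∪ T, (χ.compRelNorm L).valueAtUniformizer w ^ (-(lam.conductorExponentAt w : ℤ))),
    ?_, ?_, ?_, ?_, ?_⟩
  · exact mul_ne_zero (hΦ0 hc₀ℂ) (mul_ne_zero (hΩpK w₁) (inv_ne_zero (hΩpK w₂)))
  · exact mul_ne_zero (hΦ0 hc₁ℂ)
      (mul_ne_zero (pow_ne_zero _ (mul_ne_zero (hΩpK w₁) (hΩpK w₂))) (inv_ne_zero (pow_ne_zero _ hΩp)))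
  · exact fun χ ↦ hΦ0 (defect_ne_zero χ)
  · intro χ k
    beta_reduce
    rw [defect_pow, map_pow]
  · intro χ n hn hu hi
    refine ⟨1, fun w ↦ if w = w₁ then n else n - 1, hcont χ n hn hu hi, le_rfl, hT χ n hn hu hi, ?_⟩
    obtain ⟨m, rfl⟩ : ∃ m, n = m + 1 := ⟨n - 1, (Nat.sub_add_cancel hn).symm⟩
    have hκ₂ : (if w₂ = w₁ then m + 1 else m + 1 - 1) = m := by rw [if_neg hw.symm, Nat.add_sub_cancel]
    have hL := hLval χ (m + 1) hn hu hi (hcont χ (m + 1) hn hu hi)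
    have hrem : DeShalit1987.removedEulerFactorsAtZero (lam * χ.compRelNorm L) (S ∪ KatzCM.primesOver L p) = 1 :=
      removedEulerFactorsAtZero_eq_one fun w hw' ↦
        not_isUnramifiedAt_mul (compRelNorm_isUnramifiedAt_of_forall hu w) (hramS w hw')
    have hG₁ : DeShalit1987.gammaFactorAtZero (1 + (m + 1)) = Complex.Gamma (((m + 1 : ℕ) : ℂ) + 1) := by
      unfold DeShalit1987.gammaFactorAtZero; push_cast; ring_nf
    have hG₂ : DeShalit1987.gammaFactorAtZero (1 + m) = Complex.Gamma ((m + 1 : ℕ) : ℂ) := by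
      unfold DeShalit1987.gammaFactorAtZero; push_cast; ring_nf
    -- the complex side
    have hKatz : KatzCM.interpolationValue ι Sp S T lam (χ.compRelNorm L) 1
        (fun w ↦ if w = w₁ then m + 1 else m + 1 - 1) ϑ CK Ω ((hcont χ (m + 1) hn hu hi).continuation 0) =
        (CK * cL * (((KatzCM.embeddingAt ι Sp w₂ ϑ).im : ℝ) : ℂ) * Ω w₂ / (CH * Ω w₁)) *
          (cL' * (Real.pi : ℂ) ^ 4 * (A : ℂ) ^ 2 * 16 * ΩK ^ 4 /
            ((((KatzCM.embeddingAt ι Sp w₁ ϑ).im : ℝ) : ℂ) * (((KatzCM.embeddingAt ι Sp w₂ ϑ).im : ℝ) : ℂ) *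
              Ω w₁ ^ 2 * Ω w₂ ^ 2 * (p : ℂ))) ^ (m + 1) *
          (∏ w ∈ Sp ∪ T, (χ.compRelNorm L).valueAtUniformizer w ^ (-(lam.conductorExponentAt w : ℤ))) *
          hsiehInterpolationValue p f 𝔭 χ (m + 1) A ΩK CH := by
      unfold KatzCM.interpolationValue
      rw [archFactor_two hw huniv, hrem, prod_eulerFactor_eq hramT hu, hL, hsiehInterpolationValue_of_dvd hpN,
        hap]
      simp only [hκ₂, ite_true]
      rw [hG₁, hG₂, zero_mul, zero_mul, sub_zero, one_pow]
      exact complex_display_identity m hCH hπ hA' hΩK hI₁0 hI₂0 (hΩ w₁) (hΩ w₂) hp0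
    -- the p-adic side
    rw [hΦ, hΦ, hKatz, map_mul, map_mul, map_mul, map_pow, prod_univ_two hw huniv]
    simp only [hκ₂, ite_true]
    exact padic_display_identity m (hΩpK w₂) hΩp

/-! ### §5 The V2 socket, discharged to print-shaped hypotheses -/

/-- **V2 (E1a) — the Katz base-change-line series and the Hsieh witness generate the same ideal up to non-zero
constants**, granted (T), (C), (L), (P), (R), (N) of the module docstring: for `G` with
`KatzCM.IsBaseChangeLine ι Σ_p S T κ γ λ ϑ C_K Ω Ω_p′ G` and `Q_H` with `IsHsiehLFunction ι 𝔭 κ γ f A Ω_K C_H Ω_p Q_H`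
(odd `p`, `K` imaginary quadratic, `κ` anticyclotomic with topological generator `γ`; `L ⊃ K` Galois with exactly the
two infinite places `w₁ ≠ w₂`) there are `c, c′ ∈ 𝒪_{ℂ_p} ∖ 0` with `(C(c)·G) = (C(c′)·Q_H)` — the `hspan` of
`…ConstantScaling.heartShape_of_sockets` with `Q_L := G`. The two OPEN print-shaped inputs are `hT` (Katz type of
`λ·χ∘N`) and `hLval` (the `L`-value identity for the CM form); nothing of them is asserted.
[cite: Hsieh2014mu, Prop. 4.9 (§4.8)] [cite: Hsieh2014, Thm. A p. 712 (Doc. Math. 19)] [cite: Castella2018, Thm. 3.1 (arXiv:1704.06608 p. 9)] -/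
theorem exists_span_C_mul_eq {ι : PadicAlgCl p ≃+* ℂ} {κ : ZpExtension K p} {γ : absoluteGaloisGroup K}
    (hp2 : p ≠ 2) (hK : IsImaginaryQuadratic K) (hκ : κ.IsAnticyclotomic) (hγ : κ.IsTopGenerator γ)
    {Sp S T : Finset (HeightOneSpectrum (𝓞 L))} {lam : HeckeCharacter L} {ϑ : L} {CK : ℂ}
    {Ω : InfinitePlace L → ℂ} {ΩpK : InfinitePlace L → ℂ_[p]} {N : ℕ} {f : CuspForm (CongruenceSubgroup.Gamma0 N) 2}
    {𝔭 : HeightOneSpectrum (𝓞 K)} {A : ℝ} {ΩK CH : ℂ} {Ωp : ℂ_[p]} {QH G : PowerSeries 𝓞_ℂ_[p]}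
    (hQH : IsHsiehLFunction ι 𝔭 κ γ f A ΩK CH Ωp QH) (hGK : KatzCM.IsBaseChangeLine ι Sp S T κ γ lam ϑ CK Ω ΩpK G)
    {w₁ w₂ : InfinitePlace L} (hw : w₁ ≠ w₂) (huniv : ∀ w : InfinitePlace L, w = w₁ ∨ w = w₂)
    (hT : ∀ (χ : HeckeCharacter K) (n : ℕ), 0 < n → (∀ v : HeightOneSpectrum (𝓞 K), χ.IsUnramifiedAt v) →
      χ.HasInfinityType (fun _ ↦ (n : ℤ)) (fun _ ↦ -(n : ℤ)) →
      KatzCM.HasKatzType ι Sp (lam * χ.compRelNorm L) 1 (fun w ↦ if w = w₁ then n else n - 1))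
    (hcont : ∀ (χ : HeckeCharacter K) (n : ℕ), 0 < n → (∀ v : HeightOneSpectrum (𝓞 K), χ.IsUnramifiedAt v) →
      χ.HasInfinityType (fun _ ↦ (n : ℤ)) (fun _ ↦ -(n : ℤ)) →
      LFunction.HasEntireContinuation (heckeLFunction (lam * χ.compRelNorm L)))
    {cL cL' : ℂ} (hcL : cL ≠ 0) (hcL' : cL' ≠ 0)
    (hLval : ∀ (χ : HeckeCharacter K) (n : ℕ), 0 < n → (∀ v : HeightOneSpectrum (𝓞 K), χ.IsUnramifiedAt v) →
      χ.HasInfinityType (fun _ ↦ (n : ℤ)) (fun _ ↦ -(n : ℤ)) →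
      ∀ hL : LFunction.HasEntireContinuation (heckeLFunction (lam * χ.compRelNorm L)),
        hL.continuation 0 = cL * cL' ^ n * rankinSelbergValueHecke f χ 1)
    (hpN : p ∣ N) (hap : cuspCoeff f p = 0)
    (hramS : ∀ w ∈ S ∪ KatzCM.primesOver L p, ¬ lam.IsUnramifiedAt w)
    (hramT : ∀ w ∈ Sp ∪ T, ¬ lam.IsUnramifiedAt w)
    (hCK : CK ≠ 0) (hΩ : ∀ w, Ω w ≠ 0) (hIm : ∀ w, (KatzCM.embeddingAt ι Sp w ϑ).im ≠ 0)
    (hΩpK : ∀ w, ΩpK w ≠ 0) (hA : A ≠ 0) (hΩK : ΩK ≠ 0) (hCH : CH ≠ 0) (hΩp : Ωp ≠ 0) :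
    ∃ c c' : 𝓞_ℂ_[p], c ≠ 0 ∧ c' ≠ 0 ∧
      Ideal.span ({C c * G} : Set (PowerSeries 𝓞_ℂ_[p])) = Ideal.span {C c' * QH} := by
  obtain ⟨c₀, c₁, δ, hc₀, hc₁, hδ0, hδpow, hdisp⟩ :=
    display_relation hw huniv hT hcont hcL hcL' hLval hpN hap hramS hramT hCK hΩ hIm hΩpK hA hΩK hCH hΩp
  exact exists_span_C_mul_eq_of_isBaseChangeLine hp2 hK hκ hγ hQH hGK hc₀ hc₁ hδ0 hδpow hdisp

end Summit.BirchSwinnertonDyer.BirchSwinnertonDyer.Theorems.BiquadraticEisensteinDescentEisensteinHeartFlatCMInertBadKPrimeKatzHsiehDisplay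

end
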